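import Summits.QuantumFields.YangMills.Theorems.BalabanUVNodesN15AtRateRecord12V1
import Literature.MathematicalPhysics.QuantumFieldTheory.Balaban1983to89.Node00.Record13

/-!
# Route «BalabanUVNodes», cluster K4 «SpineRates» — node N15 = NE2 AT A STAGE-13 TUPLE RATE READING, IN THE rev-16 K3‴ SKELETON's OWN CURRENCY: the N15 conjunct of
# `KeyedRates rr` (plan g66 `K3Skeleton13.lean`, stmt-QuantumFields-19912: `∀ F θ hP, θ.Admissible F N → ∀ g₀ os, RatesAt (datumOfRecord₁₃ F N θ hP) (rr F θ hP g₀ os)`,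
# `RatesAt D R := N14At R.ne1 ∧ N15At R.ne2 ∧ N16At R.ne3 ∧ …`) — HOME-FREE: the pin-meets-estimate socket, the three layers, constant layers, the decided toys
# (empty index · LG-vector knit · dag-n15-c's `V′₁(A)`-live family · rate-less), honesty, locality

Cell `pub-ymgap`, seat `pub-ymgap-dag-n15-a` (-a KNIT-BY-NAME seat of node N15; HUMAN RULING D-0062; chair R424 venue), generation 11, part 36 (THEOREMS ONLY, 0 `def`,
0 `sorry`).  `bears_on: R4∕N15 · K3‴ SpineGivenEndpointR13 (stmt-QuantumFields-19912: its registered `stub_rates13 : ∃ rr, KeyedRates rr ∧ KeyedWindow rr` reads a TUPLE reading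
`rr : (F : T4Family) → (θ : Stage13Params F N) → θ.Provisos₁₃ F N → (ℕ → ℝ) → List (ULoop F) → RateCarriers N` — no home, no guard, no run-length index)`.  Filed
`--supports stmt-QuantumFields-19912 --as helper`.  The companion of part 33 `…N15AtRateRecord13` (the same faces at dag-n22-e's ₁₃ rate home `RRec₁₃ 𝔯`) in the currency
the K3‴ composer (dag-n27-c) reads; dag-n16-e's `…N16AtTupleReading13` (p493181) is the N16 pattern followed here.  Restate-immune: NO Theses import — the skeleton's
`RateReading N` abbrev is SPELLED OUT as its Π-type and `rr` is a section variable; `N`-generic (K3‴ instance `N = 2`).  Imports part 32 `…N15AtRateRecord12V1` (for this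
seat's `AtKeyedHome.neZero_blockFactor`, dag-n15-c's `N15AtSpineCarriers.n15At_vectorPiece_v1_of_layers` ∕ `n15At_of_isEmpty`, `N15Knit`) and def-T's `Node00.Record13`.

WHY A PIN.  N15's NE2 component has NO object of record: the η-pairing of Node 00's [B9] letters between two members at spacings η, η′ = L^{−n}η is untyped (this seat g8∕g11
census); so every N15 statement at a reading is RELATIVE TO A PIN `hpin : (rr F θ hP g₀ os).ne2 = o …` — §1 is the socket the -a knit closes the day a definer names `o`,
§3 lists which pins the tree decides TODAY.

CONTENTS.  §1 `n15_tupleReading_of_pin` (pin + `N15At` at the pinned carriers ⇒ conjunct), `n15_tupleReadingOn_of_pin` (regime `Rg F θ` inside the binder),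
`n15_tupleReading_of_pin_layers` (the three NE2⁺ layers displayed), `layers_of_n15_tupleReading` (faces).  §2 `n15_tupleReading_iff_of_constLayer` ∕ `…On…` (constant NE2
component: one `N15At (o F)` per family carrying an admissible tuple with provisos).  §3 decided toys: `n15_tupleReading_of_pin_isEmpty` (A2 trap: content-free),
★ `n15_tupleReading_of_pin_knit` (the `U ≡ 1` LG-vector knit at the family's own `F.L`: hypothesis-free and non-degenerate, `N15Knit.N15_with_zero_layers_dim4`),
★ `n15_tupleReading_of_pin_v1` (dag-n15-c's `V′₁(A)`-LIVE vector-piece family: operator layer = the producer's theorem, site∕unit displayed),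
`not_n15_tupleReading_of_pin_rateless` (a rate-less pin at an existing admissible tuple REFUTES the conjunct).  §4 `n15_tupleReading_of_no_admissible` (honesty, R422),
`n15_tupleReading_iff_of_ne2_agree` (locality: only the NE2 components are read), `exists_tupleReading_ne2_const`.

HONEST FRAMING.  Kernel bookkeeping by name; no estimate is proved here; `rr` is a PARAMETER pinned only through `hpin`; the hypothesis-free inhabitants (§3) are the
`U ≡ 1` LG-vector torus MODEL and dag-n15-c's LINEAR vector piece dressed by the linearised first-order species — NOT Bałaban's multiscale `G(U)`; no admissible Stage-13
tuple with provisos is claimed to exist (K0‴ `Record13Inhabited`, stmt-QuantumFields-19909, OPEN — by §4 the conjunct is VACUOUS where none exists); NE2⁺ NOT PRINTED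
beyond King's scalar template; **N15 is NOT discharged**; `stub_rates13` is NOT claimed (the other conjuncts and the reading's other components are other seats');
count-neutral (typed 28∕28 · discharged 5∕28 unchanged); one finite four-torus at fixed ε — NOT ℝ⁴, NOT infinite volume, NOT OS, NOT a mass gap, NOT Clay.
No decl below carries a cite tag.
-/

set_option autoImplicit false

noncomputable section

namespace Summit.QuantumFields.YangMills.BalabanUVNodes.N15.AtTupleReading13

open Literature.MathematicalPhysics.QuantumFieldTheory.Balaban1983to89
open Literature.MathematicalPhysics.QuantumFieldTheory.Balaban1983to89.T4Continuum (T4Family ULoop)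
open Literature.MathematicalPhysics.QuantumFieldTheory.Balaban1983to89.T4EtaRate (NE2PlusOperator NE2PlusSite NE2PlusUnit)
open Literature.MathematicalPhysics.QuantumFieldTheory.Balaban1983to89.NE2NodeTorus (KnitIndex knitInstance knitOp knitOp166 knitSite163 covOpKernels
  inAll rhoDist)
open Node00 (Stage13Params NE2Objects₁₁)
open Summit.QuantumFields.BalabanUV.T4Continuum.HistoryFlow (two_le_L)
open Summit.QuantumFields.YangMills.Theorems.BalabanUVNodesN15Knit (not_N15op_rateless N15_with_zero_layers_dim4)
open Summit.QuantumFields.YangMills.Theorems.N15AtSpineCarriers (n15At_of_isEmpty n15At_vectorPiece_v1_of_layers)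
open Summit.QuantumFields.YangMills.BalabanUVNodes.N15.VectorPiece (VecIndexS vecIndexS_nonempty v1VecInstance v1VecFamily4)
open Summit.QuantumFields.YangMills.BalabanUVNodes.N15.AtKeyedHome (neZero_blockFactor)
open YMDAG.UVSplit (NE2Carriers RateCarriers N15At ne2OfRecord₁₁)

variable {N : ℕ} [NeZero N]
  (rr : (F : T4Family) → (θ : Stage13Params F N) → θ.Provisos₁₃ F N → (ℕ → ℝ) → List (ULoop F) → RateCarriers N)
  (Rg : (F : T4Family) → Stage13Params F N → Prop)

/-! ## §1 The socket: a pin of the reading's NE2 component meets an estimate at the pinned carriers -/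

section Pin

variable (o : (F : T4Family) → (θ : Stage13Params F N) → θ.Provisos₁₃ F N → (ℕ → ℝ) → List (ULoop F) → NE2Carriers)
  (hpin : ∀ (F : T4Family) (θ : Stage13Params F N) (hP : θ.Provisos₁₃ F N) (g₀ : ℕ → ℝ) (os : List (ULoop F)), (rr F θ hP g₀ os).ne2 = o F θ hP g₀ os)
include hpin

/-- **PIN MEETS ESTIMATE** (the -a knit's socket in the K3‴ currency): if the tuple reading's NE2 component is PINNED to carriers `o F θ hP g₀ os` and the N15 estimate
holds at those carriers at every admissible Stage-13 tuple with provisos, the N15 conjunct of `KeyedRates rr` holds. [bookkeeping] -/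
theorem n15_tupleReading_of_pin
    (hest : ∀ (F : T4Family) (θ : Stage13Params F N) (hP : θ.Provisos₁₃ F N), θ.Admissible F N → ∀ (g₀ : ℕ → ℝ) (os : List (ULoop F)), N15At (o F θ hP g₀ os)) :
    ∀ (F : T4Family) (θ : Stage13Params F N) (hP : θ.Provisos₁₃ F N), θ.Admissible F N → ∀ (g₀ : ℕ → ℝ) (os : List (ULoop F)), N15At (rr F θ hP g₀ os).ne2 :=
  fun F θ hP hθ g₀ os => by rw [hpin]; exact hest F θ hP hθ g₀ os

/-- The same with a regime `Rg F θ` inside the binder (the guarded θ-form). [bookkeeping] -/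
theorem n15_tupleReadingOn_of_pin
    (hest : ∀ (F : T4Family) (θ : Stage13Params F N) (hP : θ.Provisos₁₃ F N), Rg F θ → θ.Admissible F N →
      ∀ (g₀ : ℕ → ℝ) (os : List (ULoop F)), N15At (o F θ hP g₀ os)) :
    ∀ (F : T4Family) (θ : Stage13Params F N) (hP : θ.Provisos₁₃ F N), Rg F θ → θ.Admissible F N →
      ∀ (g₀ : ℕ → ℝ) (os : List (ULoop F)), N15At (rr F θ hP g₀ os).ne2 :=
  fun F θ hP hRg hθ g₀ os => by rw [hpin]; exact hest F θ hP hRg hθ g₀ os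

/-- **THE THREE NE2⁺ LAYERS AT THE PINNED CARRIERS GIVE THE CONJUNCT** (the layered knit in the K3‴ currency: operator, site, unit layers displayed). [bookkeeping] -/
theorem n15_tupleReading_of_pin_layers
    (hop : ∀ (F : T4Family) (θ : Stage13Params F N) (hP : θ.Provisos₁₃ F N), θ.Admissible F N → ∀ (g₀ : ℕ → ℝ) (os : List (ULoop F)),
      NE2PlusOperator (o F θ hP g₀ os).c35 (o F θ hP g₀ os).pi (o F θ hP g₀ os).Kop)
    (hsite : ∀ (F : T4Family) (θ : Stage13Params F N) (hP : θ.Provisos₁₃ F N), θ.Admissible F N → ∀ (g₀ : ℕ → ℝ) (os : List (ULoop F)),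
      NE2PlusSite 4 (o F θ hP g₀ os).p (o F θ hP g₀ os).c35 (o F θ hP g₀ os).pi (o F θ hP g₀ os).Ksite)
    (hunit : ∀ (F : T4Family) (θ : Stage13Params F N) (hP : θ.Provisos₁₃ F N), θ.Admissible F N → ∀ (g₀ : ℕ → ℝ) (os : List (ULoop F)),
      NE2PlusUnit (o F θ hP g₀ os).c35 (o F θ hP g₀ os).pi (o F θ hP g₀ os).Kunit (o F θ hP g₀ os).inΛ (o F θ hP g₀ os).unitDist) :
    ∀ (F : T4Family) (θ : Stage13Params F N) (hP : θ.Provisos₁₃ F N), θ.Admissible F N → ∀ (g₀ : ℕ → ℝ) (os : List (ULoop F)), N15At (rr F θ hP g₀ os).ne2 :=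
  n15_tupleReading_of_pin rr o hpin fun F θ hP hθ g₀ os => ⟨hop F θ hP hθ g₀ os, hsite F θ hP hθ g₀ os, hunit F θ hP hθ g₀ os⟩

/-- **FACES**: under the pin, the conjunct delivers the three layers at every admissible tuple with provisos. [bookkeeping] -/
theorem layers_of_n15_tupleReading
    (h : ∀ (F : T4Family) (θ : Stage13Params F N) (hP : θ.Provisos₁₃ F N), θ.Admissible F N → ∀ (g₀ : ℕ → ℝ) (os : List (ULoop F)), N15At (rr F θ hP g₀ os).ne2)
    (F : T4Family) {θ : Stage13Params F N} (hP : θ.Provisos₁₃ F N) (hθ : θ.Admissible F N) (g₀ : ℕ → ℝ) (os : List (ULoop F)) :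
    NE2PlusOperator (o F θ hP g₀ os).c35 (o F θ hP g₀ os).pi (o F θ hP g₀ os).Kop ∧
      NE2PlusSite 4 (o F θ hP g₀ os).p (o F θ hP g₀ os).c35 (o F θ hP g₀ os).pi (o F θ hP g₀ os).Ksite ∧
      NE2PlusUnit (o F θ hP g₀ os).c35 (o F θ hP g₀ os).pi (o F θ hP g₀ os).Kunit (o F θ hP g₀ os).inΛ (o F θ hP g₀ os).unitDist := by
  have h' := h F θ hP hθ g₀ os
  rwa [hpin] at h'

end Pin

/-! ## §2 Constant NE2 layers: the conjunct is one `N15At` per family carrying an admissible tuple with provisos -/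

section ConstLayer

variable (o : T4Family → NE2Carriers)
  (hconst : ∀ (F : T4Family) (θ : Stage13Params F N) (hP : θ.Provisos₁₃ F N) (g₀ : ℕ → ℝ) (os : List (ULoop F)), (rr F θ hP g₀ os).ne2 = o F)
include hconst

/-- **FOR A TUPLE READING WITH CONSTANT NE2 COMPONENT `o F`, THE N15 CONJUNCT IS ONE `N15At (o F)` PER FAMILY CARRYING AN ADMISSIBLE STAGE-13 TUPLE WITH PROVISOS**
(the K3‴ binder shape, unguarded). [bookkeeping] -/
theorem n15_tupleReading_iff_of_constLayer :
    (∀ (F : T4Family) (θ : Stage13Params F N) (hP : θ.Provisos₁₃ F N), θ.Admissible F N → ∀ (g₀ : ℕ → ℝ) (os : List (ULoop F)), N15At (rr F θ hP g₀ os).ne2) ↔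
      ∀ (F : T4Family), (∃ θ : Stage13Params F N, θ.Provisos₁₃ F N ∧ θ.Admissible F N) → N15At (o F) := by
  constructor
  · rintro h F ⟨θ, hP, hθ⟩
    have h' := h F θ hP hθ (fun _ => 0) []
    rwa [hconst] at h'
  · intro h F θ hP hθ g₀ os
    rw [hconst]
    exact h F ⟨θ, hP, hθ⟩

/-- The guarded θ-form. [bookkeeping] -/
theorem n15_tupleReadingOn_iff_of_constLayer :
    (∀ (F : T4Family) (θ : Stage13Params F N) (hP : θ.Provisos₁₃ F N), Rg F θ → θ.Admissible F N → ∀ (g₀ : ℕ → ℝ) (os : List (ULoop F)), N15At (rr F θ hP g₀ os).ne2) ↔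
      ∀ (F : T4Family), (∃ θ : Stage13Params F N, θ.Provisos₁₃ F N ∧ Rg F θ ∧ θ.Admissible F N) → N15At (o F) := by
  constructor
  · rintro h F ⟨θ, hP, hRg, hθ⟩
    have h' := h F θ hP hRg hθ (fun _ => 0) []
    rwa [hconst] at h'
  · intro h F θ hP hRg hθ g₀ os
    rw [hconst]
    exact h F ⟨θ, hP, hRg, hθ⟩

end ConstLayer

/-! ## §3 The decided toys in the K3‴ currency: which pins close the conjunct hypothesis-free, which refute it -/

section Toys

/-- **THE EMPTY-INDEX PIN CLOSES THE CONJUNCT CONTENT-FREE** [decided toy, the A2 trap]: a reading whose NE2 components have NO paired instance holds the conjunct by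
`n15At_of_isEmpty` — the pin owes an INHABITED index. [bookkeeping] -/
theorem n15_tupleReading_of_pin_isEmpty
    (h : ∀ (F : T4Family) (θ : Stage13Params F N) (hP : θ.Provisos₁₃ F N) (g₀ : ℕ → ℝ) (os : List (ULoop F)), IsEmpty (rr F θ hP g₀ os).ne2.I) :
    ∀ (F : T4Family) (θ : Stage13Params F N) (hP : θ.Provisos₁₃ F N), θ.Admissible F N → ∀ (g₀ : ℕ → ℝ) (os : List (ULoop F)), N15At (rr F θ hP g₀ os).ne2 :=
  fun F θ hP _ g₀ os => @n15At_of_isEmpty _ (h F θ hP g₀ os)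

/-- **THE FAMILY-KEYED LG-VECTOR KNIT PIN CLOSES THE CONJUNCT HYPOTHESIS-FREE AND NON-DEGENERATELY** [decided toy]: if at every tuple the reading's NE2 component IS
this lineage's `U ≡ 1` Landau-gauge vector knit on the four-dimensional unit tori at the family's OWN block factor `F.L` (index `KnitIndex 3 F.L` — INHABITED —,
instances `knitInstance 3 F.L`, `Δ_k` (1.66) ∕ `H_k` (1.63) ∕ `C^{(k)}` (2.156) kernels), the conjunct holds by `N15Knit.N15_with_zero_layers_dim4` at `2 ≤ F.L`
(`HistoryFlow.two_le_L`).  MODEL level: NOT Bałaban's multiscale `G(U)`. [bookkeeping] -/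
theorem n15_tupleReading_of_pin_knit {μ ν : Fin 4} (hμν : μ ≠ ν) (a b μ' lam α β : Fin 4) (c35 p : ℝ)
    (h : ∀ (F : T4Family) (θ : Stage13Params F N) (hP : θ.Provisos₁₃ F N) (g₀ : ℕ → ℝ) (os : List (ULoop F)),
      (rr F θ hP g₀ os).ne2 =
        haveI := neZero_blockFactor F
        { I := KnitIndex 3 F.L, c35 := c35, p := p, pi := knitInstance 3 F.L, Kop := knitOp166 F.L μ ν a b, Ksite := knitSite163 F.L μ' lam,
          Kunit := covOpKernels F.L α β, inΛ := inAll F.L, unitDist := rhoDist F.L }) :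
    ∀ (F : T4Family) (θ : Stage13Params F N) (hP : θ.Provisos₁₃ F N), θ.Admissible F N → ∀ (g₀ : ℕ → ℝ) (os : List (ULoop F)), N15At (rr F θ hP g₀ os).ne2 :=
  fun F θ hP _ g₀ os => by
    haveI := neZero_blockFactor F
    rw [h F θ hP g₀ os]
    exact (N15_with_zero_layers_dim4 F.L (two_le_L F) hμν a b μ' lam α β c35 p).1

variable {d : ℕ} {L : ℕ} [NeZero L] {ι : Type} [Fintype ι] [DecidableEq ι]
  {𝔄 : Type} [NormedRing 𝔄] [NormedAlgebra ℝ 𝔄] [CompleteSpace 𝔄] (e : 𝔄 ≃L[ℝ] (ι → ℝ))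

/-- **dag-n15-c's `V′₁(A)`-LIVE PIN CLOSES THE OPERATOR LAYER OF THE CONJUNCT** [decided toy, background LIVE]: if at every tuple the NE2 component is a `V′₁` literal
(`VectorPiece.v1VecInstance`, `v1VecFamily4`; `c35 > 0`) together with the SITE and UNIT layers on it, the conjunct holds — the operator layer is the producer's
`n15At_vectorPiece_v1_of_layers` (`ne2PlusOperator_vectorPiece_v1`), NOT a hypothesis.  Linear vector piece dressed by the linearised first-order species — NOT `G(U)`.
[bookkeeping] -/
theorem n15_tupleReading_of_pin_v1 (hd : 1 ≤ d) (hL : 1 ≤ L)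
    (h : ∀ (F : T4Family) (θ : Stage13Params F N) (hP : θ.Provisos₁₃ F N) (g₀ : ℕ → ℝ) (os : List (ULoop F)),
      ∃ (c35 p : ℝ) (Ksite Kunit : ∀ j : VecIndexS d L, B9.SiteKernel (v1VecInstance (d := d) 𝔄 ι L hL j).gc (v1VecInstance (d := d) 𝔄 ι L hL j).Bf)
        (inΛ : ∀ j : VecIndexS d L, (v1VecInstance (d := d) 𝔄 ι L hL j).gc.Site → Prop)
        (unitDist : ∀ j : VecIndexS d L, (v1VecInstance (d := d) 𝔄 ι L hL j).gc.Site → (v1VecInstance (d := d) 𝔄 ι L hL j).gc.Site → ℝ),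
        0 < c35 ∧
        (rr F θ hP g₀ os).ne2 =
          { I := VecIndexS d L, c35 := c35, p := p, pi := v1VecInstance (d := d) 𝔄 ι L hL, Kop := v1VecFamily4 (d := d) 𝔄 ι e L hL,
            Ksite := Ksite, Kunit := Kunit, inΛ := inΛ, unitDist := unitDist } ∧
        NE2PlusSite 4 p c35 (v1VecInstance (d := d) 𝔄 ι L hL) Ksite ∧ NE2PlusUnit c35 (v1VecInstance (d := d) 𝔄 ι L hL) Kunit inΛ unitDist) :
    ∀ (F : T4Family) (θ : Stage13Params F N) (hP : θ.Provisos₁₃ F N), θ.Admissible F N → ∀ (g₀ : ℕ → ℝ) (os : List (ULoop F)), N15At (rr F θ hP g₀ os).ne2 :=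
  fun F θ hP _ g₀ os => by
    obtain ⟨c35, p, Ksite, Kunit, inΛ, unitDist, hc35, hlit, hsite, hunit⟩ := h F θ hP g₀ os
    rw [hlit]
    exact n15At_vectorPiece_v1_of_layers e hd hL hc35 p Ksite Kunit inΛ unitDist hsite hunit

/-- **A RATE-LESS PIN REFUTES THE CONJUNCT WHEREVER A TUPLE EXISTS** [decided toy]: if SOME admissible Stage-13 tuple with provisos exists and the reading's NE2 component
there is the literal carrying, on `knitInstance 3 2`, the RATE-LESS operator family `X_N k ≡ 2^k`, the conjunct FAILS (`N15Knit.not_N15op_rateless`).  The content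
of the conjunct is a genuine RATE of the pinned operator family. [bookkeeping] -/
theorem not_n15_tupleReading_of_pin_rateless {F : T4Family} {θ : Stage13Params F N} (hP : θ.Provisos₁₃ F N) (hθ : θ.Admissible F N)
    (g₀ : ℕ → ℝ) (os : List (ULoop F)) (c35 p : ℝ) (μ' lam α β : Fin 4)
    (hne2 : (rr F θ hP g₀ os).ne2 =
      { I := KnitIndex 3 2, c35 := c35, p := p, pi := knitInstance 3 2, Kop := knitOp 2 (fun _ _ k _ => (2 : ℝ) ^ k),
        Ksite := knitSite163 2 μ' lam, Kunit := covOpKernels 2 α β, inΛ := inAll 2, unitDist := rhoDist 2 }) :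
    ¬ ∀ (F : T4Family) (θ : Stage13Params F N) (hP : θ.Provisos₁₃ F N), θ.Admissible F N →
        ∀ (g₀ : ℕ → ℝ) (os : List (ULoop F)), N15At (rr F θ hP g₀ os).ne2 := fun h => by
  have h15 := h F θ hP hθ g₀ os
  rw [hne2] at h15
  exact not_N15op_rateless 3 c35 h15.1

end Toys

/-! ## §4 Honesty and locality -/

/-- **HONESTY (R422)**: if NO family carries an admissible Stage-13 tuple with provisos, the N15 conjunct of `KeyedRates rr` holds for EVERY reading, content-free — it bites
exactly where K0‴ `Record13Inhabited` puts a tuple. [bookkeeping] -/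
theorem n15_tupleReading_of_no_admissible (hno : ∀ (F : T4Family) (θ : Stage13Params F N), θ.Provisos₁₃ F N → ¬ θ.Admissible F N) :
    ∀ (F : T4Family) (θ : Stage13Params F N) (hP : θ.Provisos₁₃ F N), θ.Admissible F N → ∀ (g₀ : ℕ → ℝ) (os : List (ULoop F)), N15At (rr F θ hP g₀ os).ne2 :=
  fun F θ hP hθ => absurd hθ (hno F θ hP)

/-- **COMPONENT LOCALITY**: the N15 conjunct reads ONLY the NE2 components — two readings agreeing there have the same conjunct. [bookkeeping] -/
theorem n15_tupleReading_iff_of_ne2_agree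
    {rr rr' : (F : T4Family) → (θ : Stage13Params F N) → θ.Provisos₁₃ F N → (ℕ → ℝ) → List (ULoop F) → RateCarriers N}
    (hagree : ∀ (F : T4Family) (θ : Stage13Params F N) (hP : θ.Provisos₁₃ F N) (g₀ : ℕ → ℝ) (os : List (ULoop F)), (rr F θ hP g₀ os).ne2 = (rr' F θ hP g₀ os).ne2) :
    (∀ (F : T4Family) (θ : Stage13Params F N) (hP : θ.Provisos₁₃ F N), θ.Admissible F N → ∀ (g₀ : ℕ → ℝ) (os : List (ULoop F)), N15At (rr F θ hP g₀ os).ne2) ↔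
      ∀ (F : T4Family) (θ : Stage13Params F N) (hP : θ.Provisos₁₃ F N), θ.Admissible F N → ∀ (g₀ : ℕ → ℝ) (os : List (ULoop F)), N15At (rr' F θ hP g₀ os).ne2 := by
  constructor
  · intro h F θ hP hθ g₀ os; rw [← hagree]; exact h F θ hP hθ g₀ os
  · intro h F θ hP hθ g₀ os; rw [hagree]; exact h F θ hP hθ g₀ os

/-- **EVERY TUPLE-READING TYPE CARRIES THE CONSTANT NE2 READING** at prescribed carriers (so each toy above bites). [bookkeeping] -/
theorem exists_tupleReading_ne2_const (rr₀ : (F : T4Family) → (θ : Stage13Params F N) → θ.Provisos₁₃ F N → (ℕ → ℝ) → List (ULoop F) → RateCarriers N)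
    (o : NE2Carriers) :
    ∃ rr : (F : T4Family) → (θ : Stage13Params F N) → θ.Provisos₁₃ F N → (ℕ → ℝ) → List (ULoop F) → RateCarriers N,
      ∀ (F : T4Family) (θ : Stage13Params F N) (hP : θ.Provisos₁₃ F N) (g₀ : ℕ → ℝ) (os : List (ULoop F)), (rr F θ hP g₀ os).ne2 = o :=
  ⟨fun F θ hP g₀ os => { rr₀ F θ hP g₀ os with ne2 := o }, fun _ _ _ _ _ => rfl⟩

end Summit.QuantumFields.YangMills.BalabanUVNodes.N15.AtTupleReading13

end
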